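import Summits.ValiantsHypothesis.ValiantsHypothesis.Theorems.FreeSubtorusOrbitDimensionBoundStubPerSummandPrelimA

/-!
# `OrbitDimensionBound` (stmt-ValiantsHypothesis-16133), rung line `sign_covering` — stub `stub_perSummand`,
# preliminaries B: retracts of square polynomial matrices and the determinant of a retract

Second tool file for stub 1 `stub_perSummand` of `Cruxes/OrbitDimensionBound/Lines/sign_covering.lean` (route
`FreeSubtorus`).  Language (no definitions are introduced; everything is spelled out in hypotheses):

* a MORPHISM `(X_W, X_V) : N → M` between square matrices `N` (index `ι`) and `M` (index `κ`) over `ℂ[x_σ]` is a pair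
  of complex matrices with `X_W · N = M · X_V`; morphisms compose (`hom_comp`);
* `N` is a RETRACT of `M` through `(v, u)` if `v : N → M`, `u : M → N` are morphisms with `u_W v_W = 1 = u_V v_V`
  (in Kronecker-module terms: `N` is isomorphic to a direct summand of `M`).

Main result `exists_det_eq_mul_of_retract`: if `N` is a retract of `M` and `det M ≠ 0`, then
`C c · det M = det N · q` for some polynomial `q` and some constant `c ≠ 0` — the determinant of a direct summand
divides the determinant up to a unit.  Proof: the idempotent endomorphism pair `e = v u` of `M` is semisimple
(`X² − X` is squarefree), so the graded square form of preliminaries A conjugates it to `diag β` on both sides and makes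
`P M Q` block diagonal for the colouring `β = 1`; the weight-`1` block is conjugate to `N` by the square invertible
pieces of `P v`, `u P⁻¹` (square because `trace (x y) = trace (y x)` equates the two sizes), whence
`det (P M Q) = det (block₁) · det (block₀)` with `det (block₁) = const · det N`.

Helper mode (`--supports stmt-ValiantsHypothesis-16133 --as helper`).  Honest framing: [folklore] linear algebra
(Fitting / Krull–Schmidt bookkeeping for matrix pencils) towards ONE registered stub of a dormant rung line;
`OrbitDimensionBound`, `FreeSubtorus` and VP ≠ VNP are OPEN and not moved by this file.

## References
* N. Jacobson, *Basic Algebra II*, 2nd ed. (1989), §3.4 (Fitting's lemma, Krull–Schmidt) — orientation only.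
* [LandsbergRessayre2017] J. M. Landsberg, N. Ressayre, Differential Geom. Appl. 55 (2017), §3.3 (normal forms).
-/

set_option linter.dupNamespace false

namespace Summit.ValiantsHypothesis.ValiantsHypothesis.Theorems.FreeSubtorusOrbitDimensionBound.SignCovering.PerSummand

open Matrix MvPolynomial Finset Module.End
open Literature.Computability.AlgebraicComplexity
open Summit.ValiantsHypothesis.ValiantsHypothesis.Theorems.FreeSubtorusConfusionCovering

/-! ### §1 Morphisms compose -/

section Hom

variable {σ ι κ θ : Type*} [Fintype ι] [Fintype κ] [Fintype θ]

/-- Composition of morphisms of square polynomial matrices: if `X_W N₁ = N₂ X_V` and `Y_W N₂ = N₃ Y_V` then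
`(Y_W X_W) N₁ = N₃ (Y_V X_V)`. [folklore] -/
theorem hom_comp {N₁ : Matrix ι ι (MvPolynomial σ ℂ)} {N₂ : Matrix κ κ (MvPolynomial σ ℂ)}
    {N₃ : Matrix θ θ (MvPolynomial σ ℂ)} {XW XV : Matrix κ ι ℂ} {YW YV : Matrix θ κ ℂ}
    (hX : XW.map (C (σ := σ)) * N₁ = N₂ * XV.map (C (σ := σ)))
    (hY : YW.map (C (σ := σ)) * N₂ = N₃ * YV.map (C (σ := σ))) :
    (YW * XW).map (C (σ := σ)) * N₁ = N₃ * (YV * XV).map (C (σ := σ)) := by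
  rw [Matrix.map_mul, Matrix.map_mul, Matrix.mul_assoc, hX, ← Matrix.mul_assoc, hY, Matrix.mul_assoc]

/-- Difference of two morphisms with the same source and target is a morphism. [folklore] -/
theorem hom_sub {N₁ : Matrix ι ι (MvPolynomial σ ℂ)} {N₂ : Matrix κ κ (MvPolynomial σ ℂ)}
    {XW XV YW YV : Matrix κ ι ℂ}
    (hX : XW.map (C (σ := σ)) * N₁ = N₂ * XV.map (C (σ := σ)))
    (hY : YW.map (C (σ := σ)) * N₁ = N₂ * YV.map (C (σ := σ))) :
    (XW - YW).map (C (σ := σ)) * N₁ = N₂ * (XV - YV).map (C (σ := σ)) := by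
  rw [Matrix.map_sub C (map_sub C), Matrix.map_sub C (map_sub C), Matrix.sub_mul, Matrix.mul_sub, hX, hY]

/-- The identity is a morphism. [folklore] -/
theorem hom_one [DecidableEq ι] (N : Matrix ι ι (MvPolynomial σ ℂ)) :
    (1 : Matrix ι ι ℂ).map (C (σ := σ)) * N = N * (1 : Matrix ι ι ℂ).map (C (σ := σ)) := by
  rw [Matrix.map_one C C_0 C_1, Matrix.one_mul, Matrix.mul_one]

end Hom

/-! ### §2 Idempotent matrices are semisimple -/

section Idempotent

/-- For an idempotent matrix every generalised eigenvector is an eigenvector (`X² − X` is squarefree, so the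
endomorphism is semisimple). [folklore] -/
theorem toLin'_apply_eq_smul_of_idempotent {m : ℕ} (e : Matrix (Fin m) (Fin m) ℂ) (he : e * e = e)
    (μ : ℂ) (x : Fin m → ℂ) (hx : x ∈ Module.End.maxGenEigenspace (Matrix.toLin' e) μ) :
    Matrix.toLin' e x = μ • x := by
  set f : Module.End ℂ (Fin m → ℂ) := Matrix.toLin' e with hf_def
  have hf : f * f = f := by
    rw [hf_def, Module.End.mul_eq_comp, ← Matrix.toLin'_mul, he]
  have hcop : IsCoprime (Polynomial.X : Polynomial ℂ) (Polynomial.X - Polynomial.C 1) :=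
    ⟨1, -1, by rw [map_one]; ring⟩
  have hsq : Squarefree ((Polynomial.X : Polynomial ℂ) * (Polynomial.X - Polynomial.C 1)) :=
    (Polynomial.separable_X.mul Polynomial.separable_X_sub_C hcop).squarefree
  have hss : f.IsSemisimple := by
    refine Module.End.isSemisimple_of_squarefree_aeval_eq_zero hsq ?_
    rw [map_mul, map_sub, Polynomial.aeval_X, Polynomial.aeval_C, map_one, mul_sub, mul_one, hf, sub_self]
  have hfs : f.IsFinitelySemisimple := hss.isFinitelySemisimple
  rw [hfs.maxGenEigenspace_eq_eigenspace μ, Module.End.mem_eigenspace_iff] at hx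
  exact hx

end Idempotent

/-! ### §3 The determinant of a retract divides the determinant -/

section Retract

variable {σ ι : Type*} [Fintype ι] [DecidableEq ι]

omit [Fintype ι] [DecidableEq ι] in
/-- Rows of `X` outside the weight `1` vanish when `diag β · X = X`. [folklore] -/
theorem apply_eq_zero_of_diagonal_mul_eq {m : ℕ} {β : Fin m → ℂ} {X : Matrix (Fin m) ι ℂ}
    (h : Matrix.diagonal β * X = X) (i : Fin m) (a : ι) (hi : β i ≠ 1) : X i a = 0 := by
  have h1 := congrFun (congrFun h i) a
  rw [Matrix.diagonal_mul] at h1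
  have h2 : (β i - 1) * X i a = 0 := by rw [sub_mul, one_mul, h1, sub_self]
  exact (mul_eq_zero.1 h2).resolve_left (sub_ne_zero.2 hi)

omit [DecidableEq ι] in
/-- A sum over a subtype is the full sum when the summand vanishes off the subtype. [folklore] -/
theorem sum_subtype_eq_sum_of_zero {A : Type*} [AddCommMonoid A] (p : ι → Prop) [DecidablePred p] (f : ι → A)
    (hf : ∀ i, ¬ p i → f i = 0) : ∑ i : {i // p i}, f i = ∑ i, f i := by
  rw [← Fintype.sum_subtype_add_sum_subtype p f,
    Fintype.sum_eq_zero (fun i : {i // ¬ p i} => f i) (fun i => hf i.1 i.2), add_zero]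

/-- **The determinant of a retract divides the determinant, up to a non-zero constant.**  Let `M ∈ M_m(ℂ[x_σ])` with
`det M ≠ 0` and let `N ∈ M_ι(ℂ[x_σ])` be a retract of `M`: complex matrices `v_W, v_V` (`m × ι`) and `u_W, u_V`
(`ι × m`) with `v_W N = M v_V`, `u_W M = N u_V`, `u_W v_W = 1 = u_V v_V`.  Then `C c · det M = det N · q` for some
polynomial `q` and some `c ≠ 0`. [folklore] -/
theorem exists_det_eq_mul_of_retract {m : ℕ} (M : Matrix (Fin m) (Fin m) (MvPolynomial σ ℂ)) (hM : M.det ≠ 0)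
    (N : Matrix ι ι (MvPolynomial σ ℂ)) (vW vV : Matrix (Fin m) ι ℂ) (uW uV : Matrix ι (Fin m) ℂ)
    (hv : vW.map (C (σ := σ)) * N = M * vV.map (C (σ := σ)))
    (hu : uW.map (C (σ := σ)) * M = N * uV.map (C (σ := σ)))
    (huvW : uW * vW = 1) (huvV : uV * vV = 1) :
    ∃ (q : MvPolynomial σ ℂ) (c : ℂ), c ≠ 0 ∧ C c * M.det = N.det * q := by
  classical
  -- the idempotent endomorphism pair `e = v u`
  set eW : Matrix (Fin m) (Fin m) ℂ := vW * uW with heW_def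
  set eV : Matrix (Fin m) (Fin m) ℂ := vV * uV with heV_def
  have heW : eW * eW = eW := by
    rw [heW_def, Matrix.mul_assoc, ← Matrix.mul_assoc uW, huvW, Matrix.one_mul]
  have heV : eV * eV = eV := by
    rw [heV_def, Matrix.mul_assoc, ← Matrix.mul_assoc uV, huvV, Matrix.one_mul]
  have hend : eW.map C * M = M * eV.map C := by
    rw [heW_def, heV_def, Matrix.map_mul, Matrix.map_mul, Matrix.mul_assoc, hu, ← Matrix.mul_assoc, hv,
      Matrix.mul_assoc]
  -- graded square form of the idempotent pair
  obtain ⟨P, Q, β, hvan, -, -, hdiagP, hdiagQ⟩ := exists_gradedSquareForm M hM eW eV hend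
  have hPe := hdiagP (toLin'_apply_eq_smul_of_idempotent eW heW)
  have hQe := hdiagQ (toLin'_apply_eq_smul_of_idempotent eV heV)
  set Pm : Matrix (Fin m) (Fin m) ℂ := (P : Matrix (Fin m) (Fin m) ℂ) with hPm
  set Pi : Matrix (Fin m) (Fin m) ℂ := ((P⁻¹ : GL (Fin m) ℂ) : Matrix (Fin m) (Fin m) ℂ) with hPi
  set Qm : Matrix (Fin m) (Fin m) ℂ := (Q : Matrix (Fin m) (Fin m) ℂ) with hQm
  set Qi : Matrix (Fin m) (Fin m) ℂ := ((Q⁻¹ : GL (Fin m) ℂ) : Matrix (Fin m) (Fin m) ℂ) with hQi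
  have hPiP : Pi * Pm = 1 := by rw [hPi, hPm, ← Units.val_mul, inv_mul_cancel, Units.val_one]
  have hQQi : Qm * Qi = 1 := by rw [hQi, hQm, ← Units.val_mul, mul_inv_cancel, Units.val_one]
  set M' : Matrix (Fin m) (Fin m) (MvPolynomial σ ℂ) := Pm.map C * M * Qm.map C with hM'
  -- the transported retract maps
  set X : Matrix (Fin m) ι ℂ := Pm * vW with hX
  set Y : Matrix ι (Fin m) ℂ := uW * Pi with hY
  set XV : Matrix (Fin m) ι ℂ := Qi * vV with hXV
  set YV : Matrix ι (Fin m) ℂ := uV * Qm with hYV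
  have hYX : Y * X = 1 := by
    rw [hY, hX, Matrix.mul_assoc, ← Matrix.mul_assoc Pi, hPiP, Matrix.one_mul, huvW]
  have hXY : X * Y = Matrix.diagonal β := by
    rw [hX, hY, Matrix.mul_assoc, ← Matrix.mul_assoc vW, ← heW_def, ← Matrix.mul_assoc]; exact hPe
  have hYXV : YV * XV = 1 := by
    rw [hYV, hXV, Matrix.mul_assoc, ← Matrix.mul_assoc Qm, hQQi, Matrix.one_mul, huvV]
  have hXYV : XV * YV = Matrix.diagonal β := by
    rw [hXV, hYV, Matrix.mul_assoc, ← Matrix.mul_assoc vV, ← heV_def, ← Matrix.mul_assoc]; exact hQe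
  have hXrow : ∀ i a, β i ≠ 1 → X i a = 0 := apply_eq_zero_of_diagonal_mul_eq (by
    rw [← hXY, Matrix.mul_assoc, hYX, Matrix.mul_one])
  have hXVrow : ∀ i a, β i ≠ 1 → XV i a = 0 := apply_eq_zero_of_diagonal_mul_eq (by
    rw [← hXYV, Matrix.mul_assoc, hYXV, Matrix.mul_one])
  -- the colouring `β = 1` and the square pieces
  let p : Fin m → Prop := fun i => β i = 1
  set x' : Matrix {i // p i} ι ℂ := X.submatrix Subtype.val id with hx'
  set y' : Matrix ι {i // p i} ℂ := Y.submatrix id Subtype.val with hy'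
  set xV' : Matrix {i // p i} ι ℂ := XV.submatrix Subtype.val id with hxV'
  set yV' : Matrix ι {i // p i} ℂ := YV.submatrix id Subtype.val with hyV'
  have hx'y' : x' * y' = 1 := by
    ext a b
    have h1 := congrFun (congrFun hXY a.1) b.1
    rw [Matrix.mul_apply] at h1
    rw [Matrix.mul_apply]
    simp only [hx', hy', Matrix.submatrix_apply, id]
    rw [h1, Matrix.diagonal_apply, Matrix.one_apply]
    by_cases hab : a = b
    · subst hab; rw [if_pos rfl, if_pos rfl]; exact a.2
    · rw [if_neg (fun h => hab (Subtype.ext h)), if_neg hab]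
  have hy'x' : y' * x' = 1 := by
    ext a b
    have h1 := congrFun (congrFun hYX a) b
    rw [Matrix.mul_apply] at h1
    rw [Matrix.mul_apply]
    simp only [hx', hy', Matrix.submatrix_apply, id]
    rw [sum_subtype_eq_sum_of_zero p (fun i => Y a i * X i b) (fun i hi => by rw [hXrow i b hi, mul_zero])]
    exact h1
  have hxV'yV' : xV' * yV' = 1 := by
    ext a b
    have h1 := congrFun (congrFun hXYV a.1) b.1
    rw [Matrix.mul_apply] at h1
    rw [Matrix.mul_apply]
    simp only [hxV', hyV', Matrix.submatrix_apply, id]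
    rw [h1, Matrix.diagonal_apply, Matrix.one_apply]
    by_cases hab : a = b
    · subst hab; rw [if_pos rfl, if_pos rfl]; exact a.2
    · rw [if_neg (fun h => hab (Subtype.ext h)), if_neg hab]
  -- the two sizes agree: `trace (x' y') = trace (y' x')`
  have hcard : Fintype.card ι = Fintype.card {i // p i} := by
    have h1 := Matrix.trace_mul_comm x' y'
    rw [hx'y', hy'x', Matrix.trace_one, Matrix.trace_one] at h1
    exact_mod_cast h1.symm
  obtain ⟨e⟩ : Nonempty (ι ≃ {i // p i}) := ⟨Fintype.equivOfCardEq hcard⟩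
  -- square versions over `{i // p i}`
  set xs : Matrix {i // p i} {i // p i} ℂ := x'.submatrix id e.symm with hxs
  set ys : Matrix {i // p i} {i // p i} ℂ := y'.submatrix e.symm id with hys
  set xsV : Matrix {i // p i} {i // p i} ℂ := xV'.submatrix id e.symm with hxsV
  set ysV : Matrix {i // p i} {i // p i} ℂ := yV'.submatrix e.symm id with hysV
  have hreix : ∀ (A : Matrix {i // p i} ι ℂ) (B : Matrix ι {i // p i} ℂ),
      A.submatrix id e.symm * B.submatrix e.symm id = A * B := by
    intro A B
    ext a b
    simp only [Matrix.mul_apply, Matrix.submatrix_apply, id]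
    exact Equiv.sum_comp e.symm (fun k => A a k * B k b)
  have hxsys : xs * ys = 1 := by rw [hxs, hys, hreix, hx'y']
  have hxsysV : xsV * ysV = 1 := by rw [hxsV, hysV, hreix, hxV'yV']
  have hdetxs : xs.det ≠ 0 := by
    have h := congrArg Matrix.det hxsys
    rw [Matrix.det_mul, Matrix.det_one] at h
    exact left_ne_zero_of_mul_eq_one h
  have hdetxsV : xsV.det ≠ 0 := by
    have h := congrArg Matrix.det hxsysV
    rw [Matrix.det_mul, Matrix.det_one] at h
    exact left_ne_zero_of_mul_eq_one h
  -- `N` re-indexed over `{i // p i}`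
  set Ne : Matrix {i // p i} {i // p i} (MvPolynomial σ ℂ) := N.submatrix e.symm e.symm with hNe
  have hdetNe : Ne.det = N.det := by rw [hNe]; exact Matrix.det_submatrix_equiv_self e.symm N
  -- the transported morphism: `X N = M' XV`
  have hXN : X.map (C (σ := σ)) * N = M' * XV.map (C (σ := σ)) := by
    rw [hX, hXV, hM', Matrix.map_mul, Matrix.map_mul, Matrix.mul_assoc, hv, Matrix.mul_assoc, Matrix.mul_assoc,
      ← Matrix.mul_assoc (Qm.map C), ← Matrix.map_mul, hQQi, Matrix.map_one C C_0 C_1, Matrix.one_mul]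
  -- KEY: the weight-`1` block of `M'` is conjugate to `N`
  have hkey : xs.map (C (σ := σ)) * Ne = M'.toSquareBlockProp p * xsV.map (C (σ := σ)) := by
    apply Matrix.ext
    intro a b
    have h1 := congrFun (congrFun hXN a.1) (e.symm b)
    rw [Matrix.mul_apply, Matrix.mul_apply] at h1
    rw [Matrix.mul_apply, Matrix.mul_apply]
    simp only [hxs, hNe, hxsV, hx', hxV', Matrix.map_apply, Matrix.submatrix_apply, id,
      Matrix.toSquareBlockProp_def, Matrix.of_apply]
    rw [Equiv.sum_comp e.symm (fun k => C (X a.1 k) * N k (e.symm b))]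
    simp only [Matrix.map_apply] at h1
    rw [h1]
    symm
    exact sum_subtype_eq_sum_of_zero p (fun l => M' a.1 l * C (XV l (e.symm b))) (fun l hl => by
      simp only [hXVrow l _ hl, C_0, mul_zero])
  -- determinants
  have hdet1 : C xs.det * N.det = (M'.toSquareBlockProp p).det * C xsV.det := by
    have h := congrArg Matrix.det hkey
    rw [Matrix.det_mul, Matrix.det_mul, det_map_C, det_map_C, hdetNe] at h
    exact h
  have hdet2 : (M'.toSquareBlockProp p).det = C (xs.det * xsV.det⁻¹) * N.det := by
    have h3 : (M'.toSquareBlockProp p).det * C xsV.det * C xsV.det⁻¹ = (M'.toSquareBlockProp p).det := by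
      rw [mul_assoc, ← map_mul, mul_inv_cancel₀ hdetxsV, C_1, mul_one]
    rw [← h3, ← hdet1, map_mul]; ring
  have hdet3 : M'.det = (M'.toSquareBlockProp p).det * (M'.toSquareBlockProp fun i => ¬ p i).det :=
    det_eq_mul_of_graded M' β hvan p fun i j hi hj h => hj (h.symm.trans hi)
  have hdet4 : M'.det = C (Pm.det * Qm.det) * M.det := by rw [hM']; exact det_map_C_mul_mul_map_C Pm Qm M
  have hPdet : Pm.det ≠ 0 := by
    have h := congrArg Matrix.det hPiP
    rw [Matrix.det_mul, Matrix.det_one, mul_comm] at h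
    exact left_ne_zero_of_mul_eq_one h
  have hQdet : Qm.det ≠ 0 := by
    have h := congrArg Matrix.det hQQi
    rw [Matrix.det_mul, Matrix.det_one] at h
    exact left_ne_zero_of_mul_eq_one h
  refine ⟨C (xs.det * xsV.det⁻¹) * (M'.toSquareBlockProp fun i => ¬ p i).det, Pm.det * Qm.det,
    mul_ne_zero hPdet hQdet, ?_⟩
  rw [← hdet4, hdet3, hdet2]; ring

end Retract

end Summit.ValiantsHypothesis.ValiantsHypothesis.Theorems.FreeSubtorusOrbitDimensionBound.SignCovering.PerSummand
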